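import Summits.Ventures.PercRepro.S2ThreeSetCounts
import Summits.Ventures.PercRepro.S2TriangleDegree

/-!
# PercRepro — S2: THE WORST TWO-OF-THREE HITTING COUNTS AT `19` POINTS (p7, gen 16; sub-claim S2)

A top `5`-set of a `(13, 6)` core meets at least two of any three distinct circuits (it meets every pair-union,
`S2.top_five_inter_union_nonempty`), so it is counted by `S2.ncard_subsets_two_of_three_add_le`:
`#top5 + Σ_{i<j} C(19 − u_ij, 5) ≤ C(19, 5) + 2·C(19 − u, 5)` with `u_ij = |C_i ∪ C_j|`, `u = |C₁ ∪ C₂ ∪ C₃|`.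
The bound is largest when `u` is smallest; `u` is at least every `u_ij` and at least `Σ u_ij − Σ |C_i|`
(**`ncard_union_three_add_le`**), and two distinct circuits share fewer points than the smaller has
(**`ncard_inter_add_one_le_of_isCircuit_ne`**; two triangles share at most one point, `S2.ncard_inter_le_one_of_triangles`).
The numeric worst cases: three `4`-circuits **`10341`** (`hit_two_of_three_444`, the three `4`-circuits of `θ(2,2,2)`),
a triangle and two `4`-circuits **`9694`** (`_344`), two triangles and a `4`-circuit **`9626`** (`_334`; **`9009`** when the
triangles are disjoint, `_334_disjoint`), three triangles **`8271`** (`_333`). Nothing about any cell is claimed. Axioms: standard.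
-/

open scoped Matroid

namespace PercRepro

namespace S2

open Set

variable {α : Type}

/-- Two distinct circuits share fewer points than the first has. -/
theorem ncard_inter_add_one_le_of_isCircuit_ne (M : Matroid α) [M.Finite] {C C' : Set α}
    (hC : M.IsCircuit C) (hC' : M.IsCircuit C') (hne : C ≠ C') : (C ∩ C').ncard + 1 ≤ C.ncard := by
  have hfin : C.Finite := M.ground_finite.subset hC.subset_ground
  have hssub : C ∩ C' ⊂ C := by
    refine ⟨Set.inter_subset_left, fun h => hne ?_⟩
    exact hC.eq_of_subset_isCircuit hC' (fun x hx => (h hx).2)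
  exact Set.ncard_lt_ncard hssub hfin

/-- `|Y₁ ∪ Y₂| + |Y₁ ∪ Y₃| + |Y₂ ∪ Y₃| ≤ |Y₁ ∪ Y₂ ∪ Y₃| + |Y₁| + |Y₂| + |Y₃|` for finite sets. -/
theorem ncard_union_three_add_le (Y₁ Y₂ Y₃ : Set α) (h₁ : Y₁.Finite) (h₂ : Y₂.Finite) (h₃ : Y₃.Finite) :
    (Y₁ ∪ Y₂).ncard + (Y₁ ∪ Y₃).ncard + (Y₂ ∪ Y₃).ncard ≤
      (Y₁ ∪ Y₂ ∪ Y₃).ncard + Y₁.ncard + Y₂.ncard + Y₃.ncard := by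
  have e1 := Set.ncard_union_add_ncard_inter (Y₁ ∪ Y₂) Y₃ (h₁.union h₂) h₃
  have e2 := Set.ncard_union_add_ncard_inter Y₁ Y₃ h₁ h₃
  have e3 := Set.ncard_union_add_ncard_inter Y₂ Y₃ h₂ h₃
  have hdistr : (Y₁ ∪ Y₂) ∩ Y₃ = (Y₁ ∩ Y₃) ∪ (Y₂ ∩ Y₃) := Set.union_inter_distrib_right Y₁ Y₂ Y₃
  have hle : ((Y₁ ∪ Y₂) ∩ Y₃).ncard ≤ (Y₁ ∩ Y₃).ncard + (Y₂ ∩ Y₃).ncard := by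
    rw [hdistr]; exact Set.ncard_union_le _ _
  omega

/-- The triple union is at least each pair union. -/
theorem ncard_union_le_union_three_left (Y₁ Y₂ Y₃ : Set α) (h : (Y₁ ∪ Y₂ ∪ Y₃).Finite) :
    (Y₁ ∪ Y₂).ncard ≤ (Y₁ ∪ Y₂ ∪ Y₃).ncard :=
  Set.ncard_le_ncard Set.subset_union_left h

/-- The triple union is at least the outer pair union `Y₁ ∪ Y₃`. -/
theorem ncard_union_le_union_three_mid (Y₁ Y₂ Y₃ : Set α) (h : (Y₁ ∪ Y₂ ∪ Y₃).Finite) :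
    (Y₁ ∪ Y₃).ncard ≤ (Y₁ ∪ Y₂ ∪ Y₃).ncard :=
  Set.ncard_le_ncard (Set.union_subset (Set.subset_union_left.trans Set.subset_union_left) Set.subset_union_right) h

/-- The triple union is at least the last pair union `Y₂ ∪ Y₃`. -/
theorem ncard_union_le_union_three_right (Y₁ Y₂ Y₃ : Set α) (h : (Y₁ ∪ Y₂ ∪ Y₃).Finite) :
    (Y₂ ∪ Y₃).ncard ≤ (Y₁ ∪ Y₂ ∪ Y₃).ncard :=
  Set.ncard_le_ncard (Set.union_subset (Set.subset_union_right.trans Set.subset_union_left) Set.subset_union_right) h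

/-- **Three `4`-circuits at `19` points**: the two-of-three count is at most `10341`. -/
theorem hit_two_of_three_444 (x u₁₂ u₁₃ u₂₃ u : ℕ)
    (h12 : 5 ≤ u₁₂) (h12' : u₁₂ ≤ 8) (h13 : 5 ≤ u₁₃) (h13' : u₁₃ ≤ 8) (h23 : 5 ≤ u₂₃) (h23' : u₂₃ ≤ 8)
    (hu12 : u₁₂ ≤ u) (hu13 : u₁₃ ≤ u) (hu23 : u₂₃ ≤ u) (hw : u₁₂ + u₁₃ + u₂₃ ≤ u + 12)
    (h : x + (19 - u₁₂).choose 5 + (19 - u₁₃).choose 5 + (19 - u₂₃).choose 5 ≤ 11628 + 2 * (19 - u).choose 5) :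
    x ≤ 10341 := by
  have m1 : (19 - u).choose 5 ≤ (19 - u₁₂).choose 5 := Nat.choose_le_choose 5 (by omega)
  have m2 : (19 - u).choose 5 ≤ (19 - u₁₃).choose 5 := Nat.choose_le_choose 5 (by omega)
  have m3 : (19 - u).choose 5 ≤ (19 - u₂₃).choose 5 := Nat.choose_le_choose 5 (by omega)
  have m4 : (19 - u).choose 5 ≤ (19 - (u₁₂ + u₁₃ + u₂₃ - 12)).choose 5 := Nat.choose_le_choose 5 (by omega)
  generalize (19 - u).choose 5 = c at h m1 m2 m3 m4
  interval_cases u₁₂ <;> interval_cases u₁₃ <;> interval_cases u₂₃ <;> norm_num [Nat.choose] at h m1 m2 m3 m4 <;> omega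

/-- **A triangle and two `4`-circuits at `19` points**: the two-of-three count is at most `9694`. -/
theorem hit_two_of_three_344 (x u₁₂ u₁₃ u₂₃ u : ℕ)
    (h12 : 5 ≤ u₁₂) (h12' : u₁₂ ≤ 7) (h13 : 5 ≤ u₁₃) (h13' : u₁₃ ≤ 7) (h23 : 5 ≤ u₂₃) (h23' : u₂₃ ≤ 8)
    (hu12 : u₁₂ ≤ u) (hu13 : u₁₃ ≤ u) (hu23 : u₂₃ ≤ u) (hw : u₁₂ + u₁₃ + u₂₃ ≤ u + 11)
    (h : x + (19 - u₁₂).choose 5 + (19 - u₁₃).choose 5 + (19 - u₂₃).choose 5 ≤ 11628 + 2 * (19 - u).choose 5) :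
    x ≤ 9694 := by
  have m1 : (19 - u).choose 5 ≤ (19 - u₁₂).choose 5 := Nat.choose_le_choose 5 (by omega)
  have m2 : (19 - u).choose 5 ≤ (19 - u₁₃).choose 5 := Nat.choose_le_choose 5 (by omega)
  have m3 : (19 - u).choose 5 ≤ (19 - u₂₃).choose 5 := Nat.choose_le_choose 5 (by omega)
  have m4 : (19 - u).choose 5 ≤ (19 - (u₁₂ + u₁₃ + u₂₃ - 11)).choose 5 := Nat.choose_le_choose 5 (by omega)
  generalize (19 - u).choose 5 = c at h m1 m2 m3 m4
  interval_cases u₁₂ <;> interval_cases u₁₃ <;> interval_cases u₂₃ <;> norm_num [Nat.choose] at h m1 m2 m3 m4 <;> omega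

/-- **Two triangles and a `4`-circuit at `19` points**: the two-of-three count is at most `9626`. -/
theorem hit_two_of_three_334 (x u₁₂ u₁₃ u₂₃ u : ℕ)
    (h12 : 5 ≤ u₁₂) (h12' : u₁₂ ≤ 6) (h13 : 5 ≤ u₁₃) (h13' : u₁₃ ≤ 7) (h23 : 5 ≤ u₂₃) (h23' : u₂₃ ≤ 7)
    (hu12 : u₁₂ ≤ u) (hu13 : u₁₃ ≤ u) (hu23 : u₂₃ ≤ u) (hw : u₁₂ + u₁₃ + u₂₃ ≤ u + 10)
    (h : x + (19 - u₁₂).choose 5 + (19 - u₁₃).choose 5 + (19 - u₂₃).choose 5 ≤ 11628 + 2 * (19 - u).choose 5) :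
    x ≤ 9626 := by
  have m1 : (19 - u).choose 5 ≤ (19 - u₁₂).choose 5 := Nat.choose_le_choose 5 (by omega)
  have m2 : (19 - u).choose 5 ≤ (19 - u₁₃).choose 5 := Nat.choose_le_choose 5 (by omega)
  have m3 : (19 - u).choose 5 ≤ (19 - u₂₃).choose 5 := Nat.choose_le_choose 5 (by omega)
  have m4 : (19 - u).choose 5 ≤ (19 - (u₁₂ + u₁₃ + u₂₃ - 10)).choose 5 := Nat.choose_le_choose 5 (by omega)
  generalize (19 - u).choose 5 = c at h m1 m2 m3 m4
  interval_cases u₁₂ <;> interval_cases u₁₃ <;> interval_cases u₂₃ <;> norm_num [Nat.choose] at h m1 m2 m3 m4 <;> omega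

/-- **Two disjoint triangles and a `4`-circuit at `19` points**: the two-of-three count is at most `9009`. -/
theorem hit_two_of_three_334_disjoint (x u₁₃ u₂₃ u : ℕ)
    (h13 : 5 ≤ u₁₃) (h13' : u₁₃ ≤ 7) (h23 : 5 ≤ u₂₃) (h23' : u₂₃ ≤ 7)
    (hu12 : 6 ≤ u) (hu13 : u₁₃ ≤ u) (hu23 : u₂₃ ≤ u) (hw : 6 + u₁₃ + u₂₃ ≤ u + 10)
    (h : x + (19 - 6).choose 5 + (19 - u₁₃).choose 5 + (19 - u₂₃).choose 5 ≤ 11628 + 2 * (19 - u).choose 5) :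
    x ≤ 9009 := by
  have m1 : (19 - u).choose 5 ≤ (19 - 6).choose 5 := Nat.choose_le_choose 5 (by omega)
  have m2 : (19 - u).choose 5 ≤ (19 - u₁₃).choose 5 := Nat.choose_le_choose 5 (by omega)
  have m3 : (19 - u).choose 5 ≤ (19 - u₂₃).choose 5 := Nat.choose_le_choose 5 (by omega)
  have m4 : (19 - u).choose 5 ≤ (19 - (6 + u₁₃ + u₂₃ - 10)).choose 5 := Nat.choose_le_choose 5 (by omega)
  generalize (19 - u).choose 5 = c at h m1 m2 m3 m4
  interval_cases u₁₃ <;> interval_cases u₂₃ <;> norm_num [Nat.choose] at h m1 m2 m3 m4 <;> omega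

/-- **Three triangles at `19` points**: the two-of-three count is at most `8271`. -/
theorem hit_two_of_three_333 (x u₁₂ u₁₃ u₂₃ u : ℕ)
    (h12 : 5 ≤ u₁₂) (h12' : u₁₂ ≤ 6) (h13 : 5 ≤ u₁₃) (h13' : u₁₃ ≤ 6) (h23 : 5 ≤ u₂₃) (h23' : u₂₃ ≤ 6)
    (hu12 : u₁₂ ≤ u) (hu13 : u₁₃ ≤ u) (hu23 : u₂₃ ≤ u) (hw : u₁₂ + u₁₃ + u₂₃ ≤ u + 9)
    (h : x + (19 - u₁₂).choose 5 + (19 - u₁₃).choose 5 + (19 - u₂₃).choose 5 ≤ 11628 + 2 * (19 - u).choose 5) :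
    x ≤ 8271 := by
  have m1 : (19 - u).choose 5 ≤ (19 - u₁₂).choose 5 := Nat.choose_le_choose 5 (by omega)
  have m2 : (19 - u).choose 5 ≤ (19 - u₁₃).choose 5 := Nat.choose_le_choose 5 (by omega)
  have m3 : (19 - u).choose 5 ≤ (19 - u₂₃).choose 5 := Nat.choose_le_choose 5 (by omega)
  have m4 : (19 - u).choose 5 ≤ (19 - (u₁₂ + u₁₃ + u₂₃ - 9)).choose 5 := Nat.choose_le_choose 5 (by omega)
  generalize (19 - u).choose 5 = c at h m1 m2 m3 m4
  interval_cases u₁₂ <;> interval_cases u₁₃ <;> interval_cases u₂₃ <;> norm_num [Nat.choose] at h m1 m2 m3 m4 <;> omega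

end S2

end PercRepro
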